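import Summits.ValiantsHypothesis.ValiantsHypothesis.Theorems.RigidityForcesSymmetryRankRigidMinimalReprLaplaceDefs

/-!
# Sketch for the crux idea `torus-weight-tower` on `LaplaceOptimalFive` (stmt-ValiantsHypothesis-24813)

HONEST FRAMING.  Nothing here proves `LaplaceOptimalFive` / `LaplaceOptimal 5` (stmt-24813 stays OPEN), nothing moves the
crux `RankRigidMinimalRepr` (18034), and VP ≠ VNP is NOT proved.  `LaplaceOptimalFourFive` (27319) is REFUTED and is not used.
This file only TYPES the first lemmas of the idea (sorries = the statements to prove) and kernel-checks two `d = 4`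
calibrations of the «one-sided cleaning = border / two-sided cleaning = honest» picture.

The LETTER TORUS `𝕋 = (ℂˣ)^d` scales letter `a` by `φ a` in every slot.  The permutation pattern `P_d` is a `𝕋`-weight
vector (weight `𝟙 = (1,…,1)`), and `𝕋` acts on honest split decompositions (`torus_transport`).  A short factor is
LETTER-MONOMIAL when the injective points of its support all carry the same letter set on its slots (`IsLetterMonomial`;
every `𝕋`-weight vector is).  FIRST LEMMA (`laplaceOptimal_of_monomial`, all `d`): a decomposition of `P_d` in which every
term has a letter-monomial short OR long factor has Laplace weight `≥ d!` — so torus-fixed cheap arrangements are never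
honest, and a cheap honest decomposition must contain a term that is FAT on both sides.  `border_family_of_oneSided`:
a near-decomposition whose garbage (error off the permutations) has all its letter contents on the positive side of one
hyperplane through `𝟙` is pushed by a one-parameter subgroup of `𝕋` to a border family `P_d + O(s)`.
-/

namespace Summit.ValiantsHypothesis.ValiantsHypothesis.Cruxes.LaplaceOptimalFive.TorusWeightTower

open Finset

/-- `u`, read through the slots `S`, is LETTER-MONOMIAL: all injective points of its support carry the same letter SET
on `S`.  (Every weight vector of the letter torus in `⊗_{i ∈ S} ℂ^d` has this property; so does every member of a
torus-fixed short space after choosing a weight basis.) -/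
def IsLetterMonomial {d : ℕ} (S : Finset (Fin d)) (u : (Fin d → Fin d) → ℂ) : Prop :=
  ∀ v v' : Fin d → Fin d, Function.Injective v → Function.Injective v' → u v ≠ 0 → u v' ≠ 0 →
    S.image v = S.image v'

/-- BLOCK COUNT.  The permutations of `Fin d` mapping the slot set `S` onto a letter set `L` of the same size number
`|S|! · (d - |S|)!` — the size of one block of the Laplace (Young-subgroup coset) partition. -/
theorem card_perm_image_eq {d : ℕ} (S L : Finset (Fin d)) (h : S.card = L.card) :
    (Finset.univ.filter (fun σ : Equiv.Perm (Fin d) => S.image σ = L)).card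
      = S.card.factorial * (d - S.card).factorial := by
  sorry

/-- FIRST LEMMA (L1) — the MONOMIAL SKELETON of `LaplaceOptimal d`, valid for every `d` and WITHOUT the locality
hypotheses: if `∑_t u_t · w_t` equals the permutation pattern and every term has a letter-monomial short factor or a
letter-monomial long factor, then the Laplace weight is at least `d!`.  Proof intended: every permutation `σ` lies in the
support of some term (the sum is `1` at `σ`); the permutations in the support of term `t` lie in ONE block
`{σ' : σ'(S_t) = L_t}` (or `{σ' : σ'(S_tᶜ) = M_t}`), of size `|S_t|!(d-|S_t|)!` (`card_perm_image_eq`); add up. -/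
theorem laplaceOptimal_of_monomial (d N : ℕ) (T : Finset (Fin N)) (S : Fin N → Finset (Fin d))
    (u w : Fin N → (Fin d → Fin d) → ℂ)
    (hmono : ∀ t ∈ T, IsLetterMonomial (S t) (u t) ∨ IsLetterMonomial (S t)ᶜ (w t))
    (hsum : ∀ v : Fin d → Fin d, (∑ t ∈ T, u t v * w t v) = if Function.Injective v then 1 else 0) :
    d.factorial ≤ ∑ t ∈ T, (S t).card.factorial * (d - (S t).card).factorial := by
  sorry

/-- TORUS TRANSPORT.  Scaling letter `a` by `φ a` in every slot maps a decomposition of `P_d` to a decomposition of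
`(∏ a, φ a) · P_d` with the same splits (and the scaled factors are still local in their slots).  This is the action of
the letter torus on the honest locus that the Borel / Białynicki-Birula localisation of the idea uses. -/
theorem torus_transport (d N : ℕ) (T : Finset (Fin N)) (S : Fin N → Finset (Fin d))
    (u w : Fin N → (Fin d → Fin d) → ℂ) (φ : Fin d → ℂ)
    (hsum : ∀ v : Fin d → Fin d, (∑ t ∈ T, u t v * w t v) = if Function.Injective v then 1 else 0) :
    ∀ v : Fin d → Fin d,
      (∑ t ∈ T, ((∏ i ∈ S t, φ (v i)) * u t v) * ((∏ i ∈ (S t)ᶜ, φ (v i)) * w t v))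
        = if Function.Injective v then ∏ a, φ a else 0 := by
  sorry

/-- ONE-SIDED GARBAGE ⟹ BORDER FAMILY.  Let `(S_t, u_t, w_t)` be a NEAR-decomposition: `F = ∑_t u_t w_t` equals `1` on
the permutations, with arbitrary garbage `F v` at non-injective `v`.  If an integral letter weight `wt` puts every
garbage point strictly above the permutations (`∑ a, wt a < ∑ i, wt (v i)` whenever `v` is non-injective and `F v ≠ 0`:
the garbage Newton polytope misses `𝟙` on one side), then for every `s ≠ 0` the one-parameter subgroup `φ a = s ^ wt a`
(renormalised) gives a decomposition, with the SAME splits and local factors, of `P_d + (terms of positive degree in s)`: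
a border family converging to `P_d` as `s → 0`.  (The certified `d = 4` and `d = 5` border identities of the tree are of
exactly this form: `d = 4` with garbage content `{1,1,3,3}`, `d = 5` (star profile) with cancelled contents
`{0,0,1,3,3}, {0,1,1,3,3}` below and residual contents `{1,2,2,4,4}, {0,2,2,4,4}` above the hyperplane of
`wt = (0,0,1,0,1)`.) -/
theorem border_family_of_oneSided (d N : ℕ) (T : Finset (Fin N)) (S : Fin N → Finset (Fin d))
    (u w : Fin N → (Fin d → Fin d) → ℂ) (wt : Fin d → ℕ)
    (hu : ∀ t, ∀ v v' : Fin d → Fin d, (∀ i ∈ S t, v i = v' i) → u t v = u t v')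
    (hw : ∀ t, ∀ v v' : Fin d → Fin d, (∀ i, i ∉ S t → v i = v' i) → w t v = w t v')
    (hperm : ∀ v : Fin d → Fin d, Function.Injective v → (∑ t ∈ T, u t v * w t v) = 1)
    (hside : ∀ v : Fin d → Fin d, ¬ Function.Injective v → (∑ t ∈ T, u t v * w t v) ≠ 0 →
      ∑ a, wt a < ∑ i, wt (v i)) :
    ∀ s : ℂ, s ≠ 0 → ∃ u' w' : Fin N → (Fin d → Fin d) → ℂ,
      (∀ t, ∀ v v' : Fin d → Fin d, (∀ i ∈ S t, v i = v' i) → u' t v = u' t v') ∧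
      (∀ t, ∀ v v' : Fin d → Fin d, (∀ i, i ∉ S t → v i = v' i) → w' t v = w' t v') ∧
      (∀ v : Fin d → Fin d, (∑ t ∈ T, u' t v * w' t v)
        = if Function.Injective v then 1
          else s ^ ((∑ i, wt (v i)) - ∑ a, wt a) * ∑ t ∈ T, u t v * w t v) := by
  sorry

/-! ### Calibration at `d = 4` (kernel-checked): one-sided cleaning is border, two-sided cleaning costs Laplace weight

Letters `0..3`, slots `0..3`, `v = (a, b, c, e)`.  Short tensors `A = e₀₂ - e₂₀`, `A' = e₁₃ - e₃₁` (pure garbage, no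
complementary letter pair), `N = e₀₂ + e₂₀`, `K = e₁₃ + e₃₁`.  The certified `d = 4` border identity
(`…LaplaceFourBorder`) is the letter-torus orbit of the FIVE-term honest decomposition of `P₄ + E`,
`E = -K₀₂K₁₃ + K₀₃K₁₂`, whose garbage lives on the single content `{1,1,3,3}` (one-sided); adding the mirror auxiliary
`-A'₀₁A'₂₃` cleans it and gives an honest, tight (`6 · 2!2! = 24 = 4!`), three-split, non-Laplace decomposition of `P₄`. -/
section Calibration

/-- `A = e₀₂ - e₂₀`. -/
def A4 : Fin 4 → Fin 4 → ℤ := ![![0, 0, 1, 0], ![0, 0, 0, 0], ![-1, 0, 0, 0], ![0, 0, 0, 0]]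
/-- `A' = e₁₃ - e₃₁`. -/
def A4' : Fin 4 → Fin 4 → ℤ := ![![0, 0, 0, 0], ![0, 0, 0, 1], ![0, 0, 0, 0], ![0, -1, 0, 0]]
/-- `N = e₀₂ + e₂₀`. -/
def N4 : Fin 4 → Fin 4 → ℤ := ![![0, 0, 1, 0], ![0, 0, 0, 0], ![1, 0, 0, 0], ![0, 0, 0, 0]]
/-- `K = e₁₃ + e₃₁`. -/
def K4 : Fin 4 → Fin 4 → ℤ := ![![0, 0, 0, 0], ![0, 0, 0, 1], ![0, 0, 0, 0], ![0, 1, 0, 0]]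

/-- TWO-SIDED cleaning = honest and tight: six pair terms on the splits `01|23` (four terms), `02|13`, `03|12` sum to the
permutation pattern `P₄` exactly (Laplace weight `24 = 4!`, equality in `LaplaceOptimal 4`, not a Laplace expansion). -/
theorem honest_six_term_d4 : ∀ a b c e : Fin 4,
    -(A4 a b * A4 c e) - (N4 a c - K4 a c) * (N4 b e - K4 b e) + (N4 a e + K4 a e) * (N4 b c + K4 b c)
      + K4 a b * N4 c e + N4 a b * K4 c e - A4' a b * A4' c e
      = (if (a ≠ b ∧ a ≠ c ∧ a ≠ e ∧ b ≠ c ∧ b ≠ e ∧ c ≠ e) then 1 else 0) := by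
  decide

/-- ONE-SIDED cleaning = border: without the mirror auxiliary the five remaining terms equal `P₄` plus garbage
`A'₀₁A'₂₃`, and that garbage is supported exactly on the letter content `{1,1,3,3}` — one torus weight, on one side of
a hyperplane through `𝟙`; the one-parameter subgroup `wt = (0,1,0,1)` turns these five terms into the certified border
family of `…LaplaceFourBorder` (`border_family_of_oneSided`). -/
theorem one_sided_garbage_d4 : ∀ a b c e : Fin 4,
    A4' a b * A4' c e ≠ 0 → ((a = 1 ∧ b = 3) ∨ (a = 3 ∧ b = 1)) ∧ ((c = 1 ∧ e = 3) ∨ (c = 3 ∧ e = 1)) := by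
  decide

end Calibration

end Summit.ValiantsHypothesis.ValiantsHypothesis.Cruxes.LaplaceOptimalFive.TorusWeightTower
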